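import Literature.NumberTheory.EllipticCurves.PrimeDegreeIsogenyJTable
import Literature.NumberTheory.EllipticCurves.OpenImage
import Literature.NumberTheory.EllipticCurves.RationalIsogenyFrobeniusCriterion
import Literature.NumberTheory.EllipticCurves.QuadraticTwistProofs
import Literature.NumberTheory.EllipticCurves.ComplexMultiplicationShaKnappProofs
import Literature.NumberTheory.EllipticCurves.NoEverywhereGoodReductionRat
import Literature.NumberTheory.EllipticCurves.PAdicHeightsProofs
import Literature.NumberTheory.EllipticCurves.Rank1Residual.Predicates
import HarnessLib

/-!
# Eisenstein primes of an elliptic curve over `ℚ`, I: reducible `E[p]` as a rational `p`-isogeny,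
# `ord_p j` at good / multiplicative primes, and the ANOMALY-TRANSPORT criterion along `j`

HONEST FRAMING (cell `b2b-bsdres`, run/shared/lean/b2b/bsd-rank1-residual/, verbatim in every
file): the goal of the cell is to DELETE the COMBINATION-SHAPED residual classes of the
Birch–Swinnerton-Dyer formula for ALL analytic-rank `≤ 1` elliptic curves over `ℚ` — "full BSD
formula for every rank `≤ 1` curve in class `C`" assembled STRICTLY from published theorems — so
that the rank-`≤ 1` remainder becomes exactly the CONSTRUCTION-SHAPED classes, which are TYPED
(missing-input `Prop`s), NOT attempted. This is not "finishing BSD". Sub-cell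
`b2b-bsdres-eisenstein-p1` (CLASS-OWNERS.md row "X1 (r=0)"): research route; NO CLAIM BEYOND
STATED CLASSES; nothing here changes a label.

Theorems only (no definition, no named fact of our own). This is the tool file of
`EisensteinPrimesSupport.lean` (the prime support `{3, 5, 7, 13}` of the residual classes X1 and
X2). Contents:

* §1 `exists_isogeny_degree_eq_of_red` — reducible `E[p]` (`Red W p`) gives a `ℚ`-isogeny of
  degree `p` (stable line = kernel of the quotient isogeny, Silverman *AEC* III.4.12; tree
  `exists_isogeny_ker_eq_and_comp_eq_nsmul_holds`, PROVED); `mem_mazurPrimes_of_red` (granted the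
  named fact `mazur_isogeny_irreducible`, Mazur 1978 Thm. 1); `mem_jTable_of_red` (granted the
  named fact `primeDegreeIsogeny_jTable`, Cremona *Algorithms* §3.8 p. 82 / Mazur 1978 table
  p. 129: `(p, j) ∈ largePrimeIsogenyJTable` for `p ∈ {11, 17, 19, 37, 43, 67, 163}`).
* §2 `padicValRat_j_eq_of_good` / `padicValRat_j_sub_eq_of_good` — for a globally minimal `W/ℚ`
  with good reduction at `p`: `ord_p j = 3·ord_p c₄`, `ord_p (j − 1728) = 2·ord_p c₆`
  (`j = c₄³/Δ`, `j − 1728 = c₆²/Δ`, `p ∤ Δ_min`; Silverman III.1, VII.5.1 (a));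
  `padicValRat_j_neg_of_mult` — multiplicative reduction forces `ord_p j < 0` (VII.5.1 (b));
  valuation certificates `padicValRat_intCast_eq_of_dvd_of_not_dvd` (`pᵉ ∣ n`, `pᵉ⁺¹ ∤ n`).
* §3 `not_dvd_of_smul_eq_quadraticTwist` — a quadratic twist `W ≅ E^{(d)}` by a squarefree `d`
  with `p ∣ d` of a curve good at `p` is NOT good at `p` (`u⁻¹²Δ(W) = d⁶Δ(E)` has no solution in
  valuations); `not_dvd_frobeniusTrace_sub_one_of_j_eq` — the ANOMALY-TRANSPORT CRITERION read
  off an explicit integer model `E₀` (global minimal by Silverman's finite check, `c₄c₆ ≠ 0`): every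
  globally minimal `W` with `j(W) = j(E₀)` and good reduction at an odd `p ∤ Δ(E₀)` is `E₀^{(d)}`
  with `p ∤ d`, so `a_p(W) = (d/p)·a_p(E₀) = ±a_p(E₀)` (Knapp Prop. 12.10 — the tree's PROVED
  `frobeniusTrace_quadraticTwist_holds`), hence `a_p(W) ≢ 1 (mod p)` once `±a_p(E₀) ≢ 1`.

Standard axioms; no sorry; the two cited named facts enter only as hypotheses `hMaz`, `hT`.

References: B. Mazur, Invent. Math. 44 (1978) Thm. 1, table p. 129 [Mazur1978]; J. E. Cremona,
*Algorithms for Modular Elliptic Curves* (1997) §3.8 p. 82 [CremonaAlgorithms1997]; A. W. Knapp,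
*Elliptic Curves* (1992) Prop. 12.10 [Knapp1993]; J. H. Silverman, *AEC* (2009) III.1, III.4.12,
VII.1 Rem. 1.1, VII.5 Prop. 5.1, X.5 Prop. 5.4 [SilvermanAEC2009].
-/

set_option autoImplicit false

noncomputable section

open scoped Classical

open WeierstrassCurve Literature.NumberTheory.EllipticCurves
  Literature.NumberTheory.EllipticCurves.Rank1Residual

namespace Summit.BirchSwinnertonDyer.Rank1Residual.EisensteinPrimes

/-! ### §1. A reducible `E[p]` is a rational `p`-isogeny; Mazur's list; the `j`-table -/

/-- **Reducible `E[p]` gives a `ℚ`-isogeny of degree `p` out of `E`**: a `Γ_ℚ`-stable line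
`C ⊂ E[p]` (`Mazur1978.not_hasIrreducibleModPGaloisRep_iff_exists_natCard_eq`) is the kernel of the
quotient isogeny `E → E/C` over `ℚ` (Silverman *AEC* III.4.12; the tree's PROVED
`exists_isogeny_ker_eq_and_comp_eq_nsmul_holds`), of degree `#C = p`. (The argument of the tree's
`hasIrreducibleModPGaloisRep_of_forall_exists_isogeny_degree_le`, first half.)
[cite: SilvermanAEC2009, III.4 Prop. 4.12 and Remark 4.13.2] -/
theorem exists_isogeny_degree_eq_of_red (W : WeierstrassCurve ℚ) [W.IsElliptic] (p : ℕ)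
    [hp : Fact p.Prime] (hred : Red W p) :
    ∃ (W' : WeierstrassCurve ℚ) (_ : W'.IsElliptic) (ψ : Isogeny W W'), ψ.degree = p := by
  haveI : NeZero (p : ℚ) := ⟨Nat.cast_ne_zero.mpr hp.out.ne_zero⟩
  obtain ⟨H, hHstab, hHcard⟩ :=
    (Mazur1978.not_hasIrreducibleModPGaloisRep_iff_exists_natCard_eq W p).mp hred
  set S : AddSubgroup W.geomPoints := H.map (geomTorsion W (p : ℤ)).subtype with hS
  have hScard : Nat.card S = p := by
    rw [← hHcard]
    exact Nat.card_congr (H.equivMapOfInjective _ (geomTorsion W (p : ℤ)).subtype_injective).symm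
  have hSfin : (S : Set W.geomPoints).Finite :=
    Nat.finite_of_card_ne_zero (hScard ▸ hp.out.ne_zero)
  have hSstab : ∀ (σ : Field.absoluteGaloisGroup ℚ) (P : W.geomPoints),
      P ∈ S → σ • P ∈ S := by
    rintro σ P ⟨Q, hQ, rfl⟩
    exact ⟨σ • Q, hHstab σ Q hQ, rfl⟩
  obtain ⟨W', hW', g, -, hker, -, -⟩ :=
    W.exists_isogeny_ker_eq_and_comp_eq_nsmul_holds S hSfin hSstab
  refine ⟨W', hW', g, ?_⟩
  change Nat.card g.toAddMonoidHom.ker = p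
  rw [hker, hScard]

/-- **Mazur's list** (granted `mazur_isogeny_irreducible`, Mazur 1978 Thm. 1): reducible `E[p]`
forces `p ∈ {2, 3, 5, 7, 11, 13, 17, 19, 37, 43, 67, 163}`. [cite: Mazur1978, Thm. 1] -/
theorem mem_mazurPrimes_of_red (hMaz : mazur_isogeny_irreducible) (W : WeierstrassCurve ℚ)
    [W.IsElliptic] (p : ℕ) [hp : Fact p.Prime] (hred : Red W p) : p ∈ mazurPrimes := by
  by_contra hmem
  exact hred (hMaz W p hp.out hmem)

/-- **The `j`-table** (granted `primeDegreeIsogeny_jTable`, Cremona §3.8 p. 82 / Mazur 1978 table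
p. 129): reducible `E[p]` with `p ∈ {11, 17, 19, 37, 43, 67, 163}` forces
`(p, j(E)) ∈ largePrimeIsogenyJTable`. [cite: CremonaAlgorithms1997, §3.8 p. 82]
[cite: Mazur1978, Thm. 1 and table p. 129] -/
theorem mem_jTable_of_red (hT : primeDegreeIsogeny_jTable) (W : WeierstrassCurve ℚ)
    [W.IsElliptic] (p : ℕ) [Fact p.Prime]
    (hp : p ∈ ({11, 17, 19, 37, 43, 67, 163} : Finset ℕ)) (hred : Red W p) :
    (p, W.j) ∈ largePrimeIsogenyJTable := by
  obtain ⟨W', hW', ψ, hdeg⟩ := exists_isogeny_degree_eq_of_red W p hred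
  haveI := hW'
  have h := hT W W' ψ (hdeg ▸ hp)
  rwa [hdeg] at h

/-! ### §2. `ord_p j` at a prime of good / multiplicative reduction -/

section Valuations

variable (W : WeierstrassCurve ℚ) [W.IsElliptic] [W.IsGloballyMinimal] (p : ℕ) [hp : Fact p.Prime]

/-- `j(W) = c₄(M)³/Δ(M)` for the integral model `M = integralModelInt W` of a globally minimal `W`
(Silverman *AEC* III.1). [folklore] -/
theorem j_eq_intModel :
    W.j = ((integralModelInt W).c₄ : ℚ) ^ 3 / ((integralModelInt W).Δ : ℚ) := by
  have hc₄ : W.c₄ = ((integralModelInt W).c₄ : ℚ) := by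
    conv_lhs => rw [← map_integralModelInt W]
    rw [map_c₄, eq_intCast]
  have hΔ : W.Δ = ((integralModelInt W).Δ : ℚ) := by
    rw [← cast_minimalDiscriminantInt W]; rfl
  rw [WeierstrassCurve.j, Units.val_inv_eq_inv_val, coe_Δ', div_eq_inv_mul, hΔ, hc₄]

/-- `j(W) − 1728 = c₆(M)²/Δ(M)` for the integral model `M` of a globally minimal `W`
(`1728Δ = c₄³ − c₆²`, Silverman *AEC* III.1). [folklore] -/
theorem j_sub_eq_intModel :
    W.j - 1728 = ((integralModelInt W).c₆ : ℚ) ^ 2 / ((integralModelInt W).Δ : ℚ) := by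
  have hΔ0 : ((integralModelInt W).Δ : ℚ) ≠ 0 := by
    rw [show ((integralModelInt W).Δ : ℚ) = W.Δ from by rw [← cast_minimalDiscriminantInt W]; rfl]
    exact W.isUnit_Δ.ne_zero
  have hrel := (integralModelInt W).c_relation
  rw [j_eq_intModel W, sub_eq_iff_eq_add, div_add' _ _ _ hΔ0, div_left_inj' hΔ0]
  have h : ((integralModelInt W).c₄ : ℚ) ^ 3 =
      ((integralModelInt W).c₆ : ℚ) ^ 2 + 1728 * ((integralModelInt W).Δ : ℚ) := by
    exact_mod_cast (by linear_combination hrel.symm :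
      (integralModelInt W).c₄ ^ 3 = (integralModelInt W).c₆ ^ 2 + 1728 * (integralModelInt W).Δ)
  rw [h]

omit [W.IsElliptic] in
/-- Good reduction at `p` means `p ∤ Δ(M)` for the integral model `M` (Silverman *AEC* VII.5
Prop. 5.1 (a); contrapositive of the tree's `not_hasGoodReductionAtPrime_of_dvd_minimalDiscriminantInt`).
[cite: SilvermanAEC2009, VII.5 Prop. 5.1(a)] -/
theorem not_dvd_disc_of_good (hgood : Good W p) : ¬ ((p : ℤ) ∣ (integralModelInt W).Δ) :=
  fun h ↦ not_hasGoodReductionAtPrime_of_dvd_minimalDiscriminantInt W p h hgood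

/-- **`ord_p j = 3·ord_p c₄` at a prime of good reduction** (globally minimal model; `p ∤ Δ`).
[cite: SilvermanAEC2009, VII.5 Prop. 5.1(a)] -/
theorem padicValRat_j_eq_of_good (hgood : Good W p) :
    padicValRat p W.j = 3 * padicValInt p (integralModelInt W).c₄ := by
  have hpΔ := not_dvd_disc_of_good W p hgood
  have hΔ0 : (integralModelInt W).Δ ≠ 0 := fun h ↦ hpΔ (h ▸ dvd_zero _)
  rw [j_eq_intModel W]
  by_cases hc : (integralModelInt W).c₄ = 0
  · simp [hc]
  rw [padicValRat.div (pow_ne_zero _ (by exact_mod_cast hc)) (by exact_mod_cast hΔ0),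
    padicValRat.pow, padicValRat.of_int, padicValRat.of_int,
    padicValInt.eq_zero_of_not_dvd hpΔ]
  push_cast
  ring

/-- **`ord_p (j − 1728) = 2·ord_p c₆` at a prime of good reduction** (globally minimal model).
[cite: SilvermanAEC2009, VII.5 Prop. 5.1(a)] -/
theorem padicValRat_j_sub_eq_of_good (hgood : Good W p) :
    padicValRat p (W.j - 1728) = 2 * padicValInt p (integralModelInt W).c₆ := by
  have hpΔ := not_dvd_disc_of_good W p hgood
  have hΔ0 : (integralModelInt W).Δ ≠ 0 := fun h ↦ hpΔ (h ▸ dvd_zero _)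
  rw [j_sub_eq_intModel W]
  by_cases hc : (integralModelInt W).c₆ = 0
  · simp [hc]
  rw [padicValRat.div (pow_ne_zero _ (by exact_mod_cast hc)) (by exact_mod_cast hΔ0),
    padicValRat.pow, padicValRat.of_int, padicValRat.of_int,
    padicValInt.eq_zero_of_not_dvd hpΔ]
  push_cast
  ring

/-- Hence `3 ∣ ord_p j(W)` at a prime of good reduction. [folklore] -/
theorem three_dvd_padicValRat_j_of_good (hgood : Good W p) : (3 : ℤ) ∣ padicValRat p W.j :=
  ⟨_, padicValRat_j_eq_of_good W p hgood⟩

/-- Hence `2 ∣ ord_p (j(W) − 1728)` at a prime of good reduction. [folklore] -/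
theorem two_dvd_padicValRat_j_sub_of_good (hgood : Good W p) :
    (2 : ℤ) ∣ padicValRat p (W.j - 1728) :=
  ⟨_, padicValRat_j_sub_eq_of_good W p hgood⟩

omit [W.IsGloballyMinimal] in
/-- **Multiplicative reduction forces `ord_p j < 0`** (`|j|_p > 1`, Silverman *AEC* VII.5
Prop. 5.1 (b); the tree's `one_lt_norm_j_of_hasMultiplicativeReductionAtPrime`).
[cite: SilvermanAEC2009, VII.5 Prop. 5.1(b)] -/
theorem padicValRat_j_neg_of_mult (hmult : Mult W p) : padicValRat p W.j < 0 := by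
  have h := one_lt_norm_j_of_hasMultiplicativeReductionAtPrime (W := W) (p := p) hmult
  have hj0 : W.j ≠ 0 := by
    intro h0
    rw [h0, Rat.cast_zero, norm_zero] at h
    exact absurd h (by norm_num)
  rw [Padic.eq_padicNorm, padicNorm.eq_zpow_of_nonzero hj0] at h
  have h' : (1 : ℚ) < (p : ℚ) ^ (-padicValRat p W.j) := by exact_mod_cast h
  have hp1 : (1 : ℚ) < p := by exact_mod_cast hp.out.one_lt
  have := (one_lt_zpow_iff_right₀ hp1).mp h'
  omega

end Valuations

/-- `ord_p (a/b) = ord_p a` for integers `a, b` with `p ∤ b`. [folklore] -/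
theorem padicValRat_intCast_div {p : ℕ} [Fact p.Prime] (a b : ℤ) (ha : a ≠ 0) (hb : b ≠ 0)
    (hpb : ¬ ((p : ℤ) ∣ b)) : padicValRat p ((a : ℚ) / (b : ℚ)) = padicValInt p a := by
  rw [padicValRat.div (by exact_mod_cast ha) (by exact_mod_cast hb), padicValRat.of_int,
    padicValRat.of_int, padicValInt.eq_zero_of_not_dvd hpb]
  simp

/-- `ord_p n = e` from `pᵉ ∣ n` and `pᵉ⁺¹ ∤ n` (decidable certificate of a valuation). [folklore] -/
theorem padicValInt_eq_of_dvd_of_not_dvd (p : ℕ) [Fact p.Prime] {n : ℤ} {e : ℕ}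
    (he : (p : ℤ) ^ e ∣ n) (he' : ¬ (p : ℤ) ^ (e + 1) ∣ n) : padicValInt p n = e := by
  have hn : n ≠ 0 := fun h ↦ he' (h ▸ dvd_zero _)
  have h1 : e ≤ padicValInt p n := ((padicValInt_dvd_iff e n).mp he).resolve_left hn
  have h2 : ¬ e + 1 ≤ padicValInt p n :=
    fun h ↦ he' ((padicValInt_dvd_iff (e + 1) n).mpr (Or.inr h))
  omega

/-- `ord_p n = e` for a rational integer literal, from the divisibility certificate. [folklore] -/
theorem padicValRat_intCast_eq_of_dvd_of_not_dvd (p : ℕ) [Fact p.Prime] {n : ℤ} {e : ℕ}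
    (he : (p : ℤ) ^ e ∣ n) (he' : ¬ (p : ℤ) ^ (e + 1) ∣ n) : padicValRat p (n : ℚ) = e := by
  rw [padicValRat.of_int, padicValInt_eq_of_dvd_of_not_dvd p he he']

/-- `ord_p (a/b) = e` for integer literals `a, b` with `p ∤ b`, from the divisibility certificate
for `a`. [folklore] -/
theorem padicValRat_intCast_div_eq_of_dvd_of_not_dvd (p : ℕ) [Fact p.Prime] {a b : ℤ} {e : ℕ}
    (he : (p : ℤ) ^ e ∣ a) (he' : ¬ (p : ℤ) ^ (e + 1) ∣ a) (hb : b ≠ 0) (hpb : ¬ ((p : ℤ) ∣ b)) :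
    padicValRat p ((a : ℚ) / (b : ℚ)) = e := by
  have ha : a ≠ 0 := fun h ↦ he' (h ▸ dvd_zero _)
  rw [padicValRat_intCast_div a b ha hb hpb, padicValInt_eq_of_dvd_of_not_dvd p he he']

/-! ### §3. Anomaly transport along `j`: `a_p(W) = ±a_p(E₀)` for the twists of a tabulated model -/

/-- **A quadratic twist by `d` with `p ∣ d` (`d` squarefree) of a curve with good reduction at `p`
does not have good reduction at `p`.** For globally minimal `W ≅ E^{(d)}` (`C • W = E^{(d)}`):
`u⁻¹² Δ(W) = d⁶ Δ(E)` (Silverman *AEC* III.1 Table 3.1, X.5.4), and `ord_p Δ(W) = ord_p Δ(E) = 0`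
(good reduction of the minimal models, VII.5.1 (a)) with `ord_p d = 1` leaves `12·ord_p u⁻¹ = 6`,
impossible. [cite: SilvermanAEC2009, VII.5 Prop. 5.1(a) and X.5 Prop. 5.4] -/
theorem not_dvd_of_smul_eq_quadraticTwist {W E : WeierstrassCurve ℚ} [W.IsElliptic]
    [W.IsGloballyMinimal] [E.IsElliptic] [E.IsGloballyMinimal] {p : ℕ} [hp : Fact p.Prime] {d : ℤ}
    (hd : Squarefree d) {C : VariableChange ℚ} (hC : C • W = E.quadraticTwist (d : ℚ))
    (hW : Good W p) (hE : Good E p) : ¬ ((p : ℤ) ∣ d) := by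
  intro hpd
  have hd0 : d ≠ 0 := hd.ne_zero
  have hpP : Prime (p : ℤ) := Nat.prime_iff_prime_int.mp hp.out
  -- `ord_p d = 1`
  have hpd2 : ¬ (p : ℤ) ^ (1 + 1) ∣ d := by
    intro h
    have hu : IsUnit (p : ℤ) := hd (p : ℤ) (by simpa [pow_two] using h)
    exact hpP.not_unit hu
  have hvd : padicValRat p (d : ℚ) = 1 := by
    rw [padicValRat_intCast_eq_of_dvd_of_not_dvd p (e := 1) (by simpa using hpd) hpd2]; simp
  -- `ord_p Δ(W) = ord_p Δ(E) = 0`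
  have hvW : padicValRat p W.Δ = 0 := by
    rw [← cast_minimalDiscriminantInt W, padicValRat.of_int, padicValInt.eq_zero_of_not_dvd
      (show ¬ ((p : ℤ) ∣ minimalDiscriminantInt W) from not_dvd_disc_of_good W p hW)]
    simp
  have hvE : padicValRat p E.Δ = 0 := by
    rw [← cast_minimalDiscriminantInt E, padicValRat.of_int, padicValInt.eq_zero_of_not_dvd
      (show ¬ ((p : ℤ) ∣ minimalDiscriminantInt E) from not_dvd_disc_of_good E p hE)]
    simp
  -- the discriminant identity and its valuation
  have hΔ : ((C.u⁻¹ : ℚˣ) : ℚ) ^ 12 * W.Δ = (d : ℚ) ^ 6 * E.Δ := by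
    rw [← variableChange_Δ, hC, quadraticTwist_Δ]
  have hu0 : ((C.u⁻¹ : ℚˣ) : ℚ) ≠ 0 := (C.u⁻¹).ne_zero
  have hv := congrArg (padicValRat p) hΔ
  rw [padicValRat.mul (pow_ne_zero _ hu0) W.isUnit_Δ.ne_zero, padicValRat.pow,
    padicValRat.mul (pow_ne_zero _ (by exact_mod_cast hd0)) E.isUnit_Δ.ne_zero, padicValRat.pow,
    hvW, hvE, hvd] at hv
  omega

/-- `p ∤ 2d` from `p ≠ 2` and `p ∤ d`. [folklore] -/
theorem not_dvd_two_mul {p : ℕ} [hp : Fact p.Prime] (hp2 : p ≠ 2) {d : ℤ} (hpd : ¬ ((p : ℤ) ∣ d)) :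
    ¬ ((p : ℤ) ∣ 2 * d) := by
  intro h
  rcases (Nat.prime_iff_prime_int.mp hp.out).dvd_or_dvd h with h2 | h2
  · have h2' : p ∣ 2 := by exact_mod_cast h2
    exact hp2 ((Nat.prime_dvd_prime_iff_eq hp.out Nat.prime_two).mp h2')
  · exact hpd h2

/-- **ANOMALY-TRANSPORT CRITERION, read off an explicit integer model.** Let
`E₀ = [a₁, a₂, a₃, a₄, a₆]` be an integer Weierstrass equation with `q¹² ∤ Δ(E₀)` or `q ∤ c₄(E₀)`
at every prime `q` (a global minimal equation, Silverman VII.1 Rem. 1.1), `c₄(E₀) ≠ 0`,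
`c₆(E₀) ≠ 0` (`j ≠ 0, 1728`), let `p ≠ 2` be a prime with `p ∤ Δ(E₀)` (good reduction) and
`#(E₀ mod p)(𝔽_p) = n`, and suppose `±(p + 1 − n) ≢ 1 (mod p)`. Then NO globally minimal elliptic
`W/ℚ` with `j(W) = c₄(E₀)³/Δ(E₀)` and good reduction at `p` is anomalous at `p`:
`a_p(W) ≢ 1 (mod p)`. Proof: `W ≅ E₀^{(d)}` for a squarefree `d` (Silverman X.5 Prop. 5.4; tree
`exists_variableChange_eq_quadraticTwist_intCast_of_j_eq`), `p ∤ d`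
(`not_dvd_of_smul_eq_quadraticTwist`), so `a_p(W) = (d/p)·a_p(E₀) = ±(p + 1 − n)` by the twisting
formula (Knapp Prop. 12.10; tree `frobeniusTrace_quadraticTwist_holds`, PROVED).
[cite: Knapp1993, Prop. 12.10 (PDF pp. 302–303)] [cite: SilvermanAEC2009, X.5 Prop. 5.4 and Cor. 5.4.1] -/
theorem not_dvd_frobeniusTrace_sub_one_of_j_eq (E₀ : WeierstrassCurve ℤ)
    (hmin : ∀ q : ℕ, q.Prime → ¬ ((q : ℤ) ^ 12 ∣ E₀.Δ) ∨ ¬ ((q : ℤ) ∣ E₀.c₄))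
    (hc₄ : E₀.c₄ ≠ 0) (hc₆ : E₀.c₆ ≠ 0) {p : ℕ} [Fact p.Prime] (hp2 : p ≠ 2)
    (hpΔ : ¬ ((p : ℤ) ∣ E₀.Δ)) {n : ℕ}
    (hcard : Nat.card ((E₀.map (Int.castRingHom (ZMod p))).toAffine.Point) = n)
    (hne : ¬ ((p : ℤ) ∣ ((p : ℤ) + 1 - n) - 1) ∧ ¬ ((p : ℤ) ∣ -((p : ℤ) + 1 - n) - 1))
    {W : WeierstrassCurve ℚ} [W.IsElliptic] [W.IsGloballyMinimal]
    (hj : W.j = (E₀.c₄ : ℚ) ^ 3 / (E₀.Δ : ℚ)) (hgood : W.HasGoodReductionAtPrime p) :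
    ¬ ((p : ℤ) ∣ W.frobeniusTrace p - 1) := by
  have hΔ : E₀.Δ ≠ 0 := fun h ↦ hpΔ (h ▸ dvd_zero _)
  haveI : (E₀.baseChange ℚ).IsElliptic := isElliptic_baseChange_int E₀ hΔ
  haveI : (E₀.baseChange ℚ).IsGloballyMinimal := isGloballyMinimal_baseChange_int E₀ hmin
  have hjE : W.j = (E₀.baseChange ℚ).j := by rw [j_baseChange_int]; exact hj
  obtain ⟨d, -, hsq, C, hC⟩ := exists_variableChange_eq_quadraticTwist_intCast_of_j_eq hjE
    (j_baseChange_int_ne_zero E₀ hc₄) (j_baseChange_int_ne_1728 E₀ hc₆)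
  have hgoodE : (E₀.baseChange ℚ).HasGoodReductionAtPrime p :=
    hasGoodReductionAtPrime_baseChange_int E₀ p hpΔ
  have hpd : ¬ ((p : ℤ) ∣ d) := not_dvd_of_smul_eq_quadraticTwist hsq hC hgood hgoodE
  have htr := frobeniusTrace_quadraticTwist_holds (E₀.baseChange ℚ) W d hsq ⟨C, hC⟩ p
    (not_dvd_two_mul hp2 hpd) (by rw [minimalDiscriminantInt_baseChange_int]; exact hpΔ)
  rw [frobeniusTrace_baseChange_int E₀ hcard] at htr
  have hdZ : ((d : ℤ) : ZMod p) ≠ 0 := by rwa [Ne, ZMod.intCast_zmod_eq_zero_iff_dvd]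
  rcases legendreSym.eq_one_or_neg_one (p := p) hdZ with h1 | h1 <;> rw [h1] at htr
  · rw [htr, one_mul]; exact hne.1
  · rw [htr, neg_one_mul]; exact hne.2

end Summit.BirchSwinnertonDyer.Rank1Residual.EisensteinPrimes

end
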